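import Summits.CriticalPhenomena.Ising3DConformalLimit.Theorems.HRP2Rigidity.Negative.CoordinateMirrorsInsufficient
import Summits.CriticalPhenomena.Ising3DConformalLimit.Theorems.HRP2Rigidity.Negative.Descent
import HarnessLib

/-!
# Crux `HyperoctahedralRP.HRP2Rigidity` (stmt-CriticalPhenomena-1979) — negative side: the Riesz kernel is reflection
# positive for EVERY mirror, and degree monotonicity (Schur descent) becomes unconditional

THEOREM-ONLY file.  `CoordinateMirrorsInsufficient.lean` proved that the Riesz kernel `‖x‖^(-2Δ)`, `Δ ≥ 1/2`, on
`ℝ³` is reflection positive with respect to the three COORDINATE mirrors (Källén–Lehmann representation of the crux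
`UnitSpeedTwoPoint`).  Since the kernel is radial, transporting by the orthogonal reflection that exchanges `e₀` with
an arbitrary unit vector gives reflection positivity with respect to EVERY mirror through the origin
(`riesz_isMirrorRPKernel_of_ne_zero`; Frank–Lieb 2010, Lemma 2.1; for `Δ = 1/2` the Newtonian potential,
Glimm–Jaffe Prop. 6.2.5: `inv_norm_isMirrorRPKernel`).  Consequently the hypothesis `hround` of the refuter's
Δ-monotonicity theorem `hrp2Rigidity_descent` (`Descent.lean`: a nine-mirror counterexample in degree `-2Δ` gives
one in degree `-2(Δ + Δ')` by the Schur product with `‖x‖^(-2Δ')`) is discharged for every `Δ' ≥ 1/2`: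
`hrp2Rigidity_descent_of_le` — non-rigidity is upward closed under `Δ ↦ Δ + Δ'`, `Δ' ≥ 1/2`, unconditionally.

O(3) writer seat, cell pub-ising3x, 2026-08-25 (paper draft HOME/nine-mirror-isotropy, Remark 6.4 (iii) and
Remark 5.14); supports item stmt-CriticalPhenomena-1979.  Standard axioms only.
-/

noncomputable section

open Literature.MathematicalPhysics.QuantumFieldTheory
open scoped InnerProductSpace

namespace Summit.CriticalPhenomena.Ising3DConformalLimit.Theorems.HRP2Rigidity.Negative

/-- **The Riesz kernel `‖x‖^(-2Δ)`, `Δ ≥ 1/2`, on `ℝ³` is reflection positive with respect to every mirror** through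
the origin (normal `n ≠ 0`), not only the coordinate ones: the kernel is radial, so the coordinate case
`riesz_isMirrorRPKernel_single` transports along the reflection exchanging `e₀` and `n/‖n‖`.
[cite: FrankLieb2010, Lemma 2.1] -/
theorem riesz_isMirrorRPKernel_of_ne_zero {Δ : ℝ} (hΔ : 1 / 2 ≤ Δ) {n : EuclideanSpace ℝ (Fin 3)} (hn : n ≠ 0) :
    IsMirrorRPKernel n (fun x : EuclideanSpace ℝ (Fin 3) => ‖x‖ ^ (-(2 * Δ))) := by
  have hnorm : 0 < ‖n‖ := norm_pos_iff.2 hn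
  -- an isometry mapping `e₀` to the unit normal `n / ‖n‖`
  obtain ⟨R, hR⟩ : ∃ R : EuclideanSpace ℝ (Fin 3) ≃ₗᵢ[ℝ] EuclideanSpace ℝ (Fin 3),
      R (EuclideanSpace.single (0 : Fin 3) (1 : ℝ)) = ‖n‖⁻¹ • n := by
    refine ⟨((ℝ ∙ (EuclideanSpace.single (0 : Fin 3) (1 : ℝ) - ‖n‖⁻¹ • n))ᗮ).reflection,
      Submodule.reflection_sub ?_⟩
    rw [norm_smul, norm_inv, norm_norm, inv_mul_cancel₀ hnorm.ne']
    simp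
  have hK : ∀ x : EuclideanSpace ℝ (Fin 3), (fun x : EuclideanSpace ℝ (Fin 3) => ‖x‖ ^ (-(2 * Δ))) (R x) =
      (fun x : EuclideanSpace ℝ (Fin 3) => ‖x‖ ^ (-(2 * Δ))) x :=
    fun x => by simp only [LinearIsometryEquiv.norm_map]
  have hu : IsMirrorRPKernel (‖n‖⁻¹ • n) (fun x : EuclideanSpace ℝ (Fin 3) => ‖x‖ ^ (-(2 * Δ))) := by
    rw [← hR]
    exact (IsMirrorRPKernel.map_normal_iff_of_invariant R hK).2 (riesz_isMirrorRPKernel_single hΔ 0)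
  have h := (IsMirrorRPKernel.smul_normal_iff (K := fun x : EuclideanSpace ℝ (Fin 3) => ‖x‖ ^ (-(2 * Δ)))
    (n := ‖n‖⁻¹ • n) hnorm).2 hu
  rwa [smul_smul, mul_inv_cancel₀ hnorm.ne', one_smul] at h

/-- In particular the Newtonian kernel `‖x‖⁻¹` on `ℝ³` is reflection positive for every mirror through the origin.
[cite: GlimmJaffeQP1987, Prop. 6.2.5] -/
theorem inv_norm_isMirrorRPKernel {n : EuclideanSpace ℝ (Fin 3)} (hn : n ≠ 0) :
    IsMirrorRPKernel n (fun x : EuclideanSpace ℝ (Fin 3) => ‖x‖⁻¹) := by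
  refine (riesz_isMirrorRPKernel_of_ne_zero (Δ := 1 / 2) le_rfl hn).congr fun x _ => ?_
  norm_num [Real.rpow_neg_one]

/-- The Riesz kernel `‖x‖^(-2Δ')`, `Δ' ≥ 1/2`, is reflection positive for the nine lattice mirror normals
`eᵢ, eᵢ ± eⱼ` (the hypothesis `hround` of `hrp2Rigidity_descent`). [cite: FrankLieb2010, Lemma 2.1] -/
theorem riesz_isMirrorRPKernel_latticeNormals {Δ' : ℝ} (hΔ' : 1 / 2 ≤ Δ') :
    ∀ n : EuclideanSpace ℝ (Fin 3), (∃ i j : Fin 3, i ≠ j ∧ (n = EuclideanSpace.single i 1 ∨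
      n = EuclideanSpace.single i 1 + EuclideanSpace.single j 1 ∨
      n = EuclideanSpace.single i 1 - EuclideanSpace.single j 1)) →
      IsMirrorRPKernel n (fun x : EuclideanSpace ℝ (Fin 3) => ‖x‖ ^ (-(2 * Δ'))) :=
  fun _ hn => riesz_isMirrorRPKernel_of_ne_zero hΔ' (ne_zero_of_mem_latticeMirrorNormals hn)

/-- **Δ-monotonicity, unconditional** (discharging the hypothesis `hround` of `hrp2Rigidity_descent` for every
`Δ' ≥ 1/2`): if nine-mirror rigidity holds in degree `-2(Δ + Δ')` with `Δ' ≥ 1/2`, it holds in degree `-2Δ`; equivalently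
a nine-mirror reflection positive anisotropic kernel of degree `-2Δ` yields one of every degree `-2(Δ + Δ')`,
`Δ' ≥ 1/2`, by the Schur product with the Riesz kernel. [folklore] -/
theorem hrp2Rigidity_descent_of_le {Δ Δ' : ℝ} (hΔ' : 1 / 2 ≤ Δ')
    (h : ∀ (K : (EuclideanSpace ℝ (Fin 3)) → ℝ), ContinuousOn K {0}ᶜ → (∀ x, x ≠ 0 → 0 < K x) →
      (∀ c : ℝ, 0 < c → ∀ x, K (c • x) = c ^ (-(2 * (Δ + Δ'))) * K x) →
      (∀ n : (EuclideanSpace ℝ (Fin 3)), (∃ i j : Fin 3, i ≠ j ∧ (n = EuclideanSpace.single i 1 ∨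
        n = EuclideanSpace.single i 1 + EuclideanSpace.single j 1 ∨
        n = EuclideanSpace.single i 1 - EuclideanSpace.single j 1)) →
        (∀ x, K (((ℝ ∙ n)ᗮ).reflection x) = K x) ∧ IsMirrorRPKernel n K) →
      ∀ (R : (EuclideanSpace ℝ (Fin 3)) ≃ₗᵢ[ℝ] (EuclideanSpace ℝ (Fin 3))) (x : (EuclideanSpace ℝ (Fin 3))),
        K (R x) = K x)
    (K : (EuclideanSpace ℝ (Fin 3)) → ℝ) (hc : ContinuousOn K {0}ᶜ) (hpos : ∀ x, x ≠ 0 → 0 < K x)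
    (hhom : ∀ c : ℝ, 0 < c → ∀ x, K (c • x) = c ^ (-(2 * Δ)) * K x)
    (hnine : ∀ n : (EuclideanSpace ℝ (Fin 3)), (∃ i j : Fin 3, i ≠ j ∧ (n = EuclideanSpace.single i 1 ∨
      n = EuclideanSpace.single i 1 + EuclideanSpace.single j 1 ∨
      n = EuclideanSpace.single i 1 - EuclideanSpace.single j 1)) →
      (∀ x, K (((ℝ ∙ n)ᗮ).reflection x) = K x) ∧ IsMirrorRPKernel n K)
    (R : (EuclideanSpace ℝ (Fin 3)) ≃ₗᵢ[ℝ] (EuclideanSpace ℝ (Fin 3))) (x : (EuclideanSpace ℝ (Fin 3))) :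
    K (R x) = K x :=
  hrp2Rigidity_descent (riesz_isMirrorRPKernel_latticeNormals hΔ') h K hc hpos hhom hnine R x

end Summit.CriticalPhenomena.Ising3DConformalLimit.Theorems.HRP2Rigidity.Negative

end
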